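import Summits.AtomisticToContinuum.BoseEinsteinCondensation.Theorems.BECRewardDescentRewardChordBoundZeroMomentumOfGroundState
import Summits.AtomisticToContinuum.BoseEinsteinCondensation.Theorems.BECRewardDescentRewardChordBoundDepletionDictionary
import Literature.MathematicalPhysics.QuantumManyBody.PeriodicMaxFormSimplicity

/-!
# Stub 4b `stub_rewardedZeroMomentumIntegrable` of crux `RewardChordBound` (stmt-AtomisticToContinuum-12876):
# translation-invariant near-minimisers of the rewarded periodic `N`-boson form, integrable pair potentials

For a repulsive finite-range pair potential `v` with `∫_{ℝ³} v(|x|) dx < ∞`, every `N ≥ 1`, `L > 0`, `s > 0` with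
`R(s) = inf_Ψ F_s(Ψ) < ∞` (`F_s(Ψ) = ⟨Ψ, HΨ⟩ + s(N - ⟨Ψ, n̂₀Ψ⟩)` over periodic `C¹` Bose trial states), and every
`δ > 0`, there is a trial state `Ψ` invariant under simultaneous translation of all particles with
`F_s(Ψ) ≤ R(s) + δ` (zero total momentum of the rewarded ground state).

Route (lead's plan, §4, in the variant WITHOUT uniqueness): the rewarded ground-state class
`rewardedGroundStates hL hv hW s = {η ∈ Bose sector | maxFormR s v L η ≤ R(s)‖η‖²}` of the Literature max-form
package (`PeriodicSlotDepletion.lean`) is a CLOSED SUBSPACE (rewarded max-form bound + parallelogram law + lower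
semicontinuity), stable under the diagonal translations `T_b` (`PeriodicMaxFormTranslation.lean`) and under
`η ↦ |η|` (Beurling–Deny for the kinetic part and for the depletion, `TorusSlotShiftDirichlet.lean`), and
non-trivial (direct method: a minimising sequence of trial states has bounded graph norm, the form embedding is
compact — `isCompactOperator_formEmbed`, Rellich — and the rewarded maximal form is lower semicontinuous); the
abstract assembly `…RewardChordBoundZeroMomentumOfGroundState.exists_hasTotalMomentum_rewardedEnergy_le` then
produces zero-momentum near-minimisers of `rewardedEnergy = F_s` (`…DepletionDictionary`). This file supplies the
translation and `|·|` stability, the closedness, the rewarded max-form bound (`R(s)‖η‖² ≤ maxFormR η` on the Bose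
sector, from `exists_trialState_maxForm_approx`), the non-triviality of the rewarded class, and the stub. No
uniqueness / positivity improvement of the rewarded ground state is used.
-/

noncomputable section

open MeasureTheory Filter UnitAddTorus Complex
open scoped ENNReal NNReal Topology InnerProductSpace ComplexConjugate

namespace Summit.AtomisticToContinuum.BoseEinsteinCondensation.Cruxes.RewardChordBound.Birth.ZeroMomentumIntegrable

open Literature.MathematicalPhysics.QuantumManyBody.BoseGas Literature.Analysis.FunctionSpaces
  Literature.Analysis.OperatorTheory
open Summit.AtomisticToContinuum.BoseEinsteinCondensation.Cruxes.RewardChordBound.Birth.ZeroMomentumOfGroundState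
  Summit.AtomisticToContinuum.BoseEinsteinCondensation.Cruxes.RewardChordBound.Birth.DepletionDictionary

-- The measure on `ℝ/ℤ` is the Haar PROBABILITY measure, as in `PeriodicFormDomain.lean`.
attribute [local instance] Literature.MathematicalPhysics.QuantumManyBody.BoseGas.formDomain_measureSpace
  Literature.MathematicalPhysics.QuantumManyBody.BoseGas.formDomain_isProbabilityMeasure
  Literature.MathematicalPhysics.QuantumManyBody.BoseGas.formDomain_isProbabilityMeasure_pi

variable {N : ℕ} {L : ℝ} {v : ℝ → ℝ≥0∞} {s : ℝ}

/-- Local notation for the Hilbert space `L²((ℝ/ℤ)^{3N})`, as in `PeriodicFormDomain.lean`. -/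
local notation "L2T " N':max => Lp ℂ 2 (volume : Measure (UnitAddTorus (Fin N' × Fin 3)))

/-! ### Translation invariance of the rewarded maximal form -/

/-- **The depletion is invariant under diagonal translations** (its spectral weights only see `|⟪eₙ, η⟫|`).
[folklore] -/
theorem depletion_translateLp (b : UnitAddTorus (Fin 3)) (η : L2T N) :
    depletion N (translateLp b η) = depletion N η := by
  rw [depletion_eq_sum_tsum, depletion_eq_sum_tsum]
  refine Finset.sum_congr rfl fun i _ => tsum_congr fun n => ?_
  rw [← coe_nnnorm, ← coe_nnnorm ⟪(mFourierLp 2 n : L2T N), η⟫_ℂ, nnnorm_inner_mFourierLp_translateLp]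

/-- **The rewarded maximal form is invariant under diagonal translations.** [folklore] -/
theorem maxFormR_translateLp (hL : 0 < L) (s : ℝ) (v : ℝ → ℝ≥0∞) (b : UnitAddTorus (Fin 3)) (η : L2T N) :
    maxFormR s v L (translateLp b η) = maxFormR s v L η := by
  rw [maxFormR_def, maxFormR_def, maxForm_translateLp hL, depletion_translateLp]

/-- **Translates of rewarded ground states are rewarded ground states.** [folklore] -/
theorem translateLp_mem_rewardedGroundStates (hL : 0 < L) (hv : Measurable v)
    (hW : ∫⁻ X in cellN N L, periodicInteraction v L X ≠ ⊤) (s : ℝ) (b : UnitAddTorus (Fin 3)) {η : L2T N}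
    (hη : η ∈ rewardedGroundStates hL hv hW s) : translateLp b η ∈ rewardedGroundStates hL hv hW s := by
  refine ⟨translateLp_mem_boseSymmetric b hη.1, ?_⟩
  rw [maxFormR_translateLp hL, norm_translateLp]
  exact hη.2

/-! ### `|η|` does not increase the rewarded maximal form (Beurling–Deny for the depletion) -/

/-- **`‖(1 - Pᵢ)|η|‖ ≤ ‖(1 - Pᵢ)η‖`**: the one-slot depletion does not increase under `η ↦ |η|`
(`TorusSlotShiftDirichlet.tsum_slotWeight_norm_le`). [folklore] -/
theorem norm_exciteProj_absLp_sq_le (i : Fin N) (η : L2T N) :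
    ‖exciteProj N i (absLp η)‖ ^ 2 ≤ ‖exciteProj N i η‖ ^ 2 := by
  rw [← ENNReal.ofReal_le_ofReal_iff (sq_nonneg _), ofReal_norm_exciteProj_sq, ofReal_norm_exciteProj_sq]
  have hcoef : ∀ n, mFourierCoeff ((absLp η : L2T N) : UnitAddTorus (Fin N × Fin 3) → ℂ) n =
      mFourierCoeff (fun t => (((‖(η : UnitAddTorus (Fin N × Fin 3) → ℂ) t‖ : ℝ) : ℂ))) n := fun n =>
    mFourierCoeff_compLp lipschitzWith_absC _ η n
  have h := tsum_slotWeight_norm_le (α := Fin N) (κ := Fin 3) (Lp.memLp η) i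
  have hw : ∀ (c : (Fin N × Fin 3 → ℤ) → ℂ) (n : Fin N × Fin 3 → ℤ),
      (if (fun k => n (i, k)) = 0 then (0 : ℝ≥0∞) else ‖c n‖ₑ ^ 2) =
        (if (fun k => n (i, k)) = 0 then (0 : ℝ≥0∞) else 1) * ‖c n‖ₑ ^ 2 := fun c n => by
    split_ifs
    · rw [zero_mul]
    · rw [one_mul]
  simp only [hcoef, hw]
  exact h

/-- **`dep(|η|) ≤ dep(η)`**. [folklore] -/
theorem depletion_absLp_le (η : L2T N) : depletion N (absLp η) ≤ depletion N η :=
  Finset.sum_le_sum fun i _ => norm_exciteProj_absLp_sq_le i η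

/-- **`maxFormR(|η|) ≤ maxFormR(η)`** for `s ≥ 0` (Kato's inequality for the kinetic part, invariance of the
potential part, Beurling–Deny for the depletion). [folklore] -/
theorem maxFormR_absLp_le {s : ℝ} (hs : 0 ≤ s) (v : ℝ → ℝ≥0∞) (L : ℝ) (η : L2T N) :
    maxFormR s v L (absLp η) ≤ maxFormR s v L η := by
  rw [maxFormR_def, maxFormR_def]
  refine add_le_add ?_ (ENNReal.ofReal_le_ofReal (mul_le_mul_of_nonneg_left (depletion_absLp_le η) hs))
  rw [maxForm, maxForm, absLp, maxFormPot_compLp_eq _ _ (fun z => by simp)]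
  exact add_le_add (maxFormKin_compLp_le_of_one _ _ η) le_rfl

/-- **`|η|` is a rewarded ground state if `η` is** (`s ≥ 0`). [folklore] -/
theorem absLp_mem_rewardedGroundStates' (hL : 0 < L) (hv : Measurable v)
    (hW : ∫⁻ X in cellN N L, periodicInteraction v L X ≠ ⊤) {s : ℝ} (hs : 0 ≤ s) {η : L2T N}
    (hη : η ∈ rewardedGroundStates hL hv hW s) : absLp η ∈ rewardedGroundStates hL hv hW s := by
  refine ⟨compLp_mem_boseSymmetric _ _ hη.1, (maxFormR_absLp_le hs v L η).trans ?_⟩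
  rw [norm_absLp]
  exact hη.2

/-! ### Lower semicontinuity of the rewarded maximal form; the rewarded class is closed -/

/-- **Lower semicontinuity of the rewarded maximal form**: if `xⱼ → η` in `L²` and `maxFormR xⱼ ≤ cⱼ → C`,
then `maxFormR η ≤ C` (Fatou for the kinetic and potential parts along an a.e.-convergent
subsequence, continuity of the depletion). [folklore] -/
theorem maxFormR_le_of_tendsto' (hL : 0 < L) (hv : Measurable v)
    (hW : ∫⁻ X in cellN N L, periodicInteraction v L X ≠ ⊤) {s : ℝ} {x : ℕ → L2T N} {η : L2T N}
    (hx : Tendsto x atTop (𝓝 η)) {c : ℕ → ℝ≥0∞} {C : ℝ≥0∞} (hc : ∀ j, maxFormR s v L (x j) ≤ c j)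
    (hC : Tendsto c atTop (𝓝 C)) : maxFormR s v L η ≤ C := by
  obtain ⟨φ, hφ, hae⟩ := (tendstoInMeasure_of_tendsto_Lp hx).exists_seq_tendsto_ae
  have hx' : Tendsto (x ∘ φ) atTop (𝓝 η) := hx.comp hφ.tendsto_atTop
  have hkin := maxFormKin_le_liminf L hx'
  have hpot := maxFormPot_le_liminf_of_tendsto_ae hL hv hW (x := x ∘ φ) hae
  have hdep : Tendsto (fun j => ENNReal.ofReal (s * depletion N ((x ∘ φ) j))) atTop
      (𝓝 (ENNReal.ofReal (s * depletion N η))) :=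
    (ENNReal.continuous_ofReal.tendsto _).comp (((continuous_depletion.tendsto η).comp hx').const_mul s)
  calc maxFormR s v L η = maxFormKin L η + maxFormPot v L η + ENNReal.ofReal (s * depletion N η) := rfl
    _ ≤ liminf (fun j => maxFormKin L ((x ∘ φ) j)) atTop + liminf (fun j => maxFormPot v L ((x ∘ φ) j)) atTop +
          liminf (fun j => ENNReal.ofReal (s * depletion N ((x ∘ φ) j))) atTop :=
        add_le_add (add_le_add hkin hpot) hdep.liminf_eq.symm.le
    _ ≤ liminf (fun j => maxFormKin L ((x ∘ φ) j) + maxFormPot v L ((x ∘ φ) j)) atTop +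
          liminf (fun j => ENNReal.ofReal (s * depletion N ((x ∘ φ) j))) atTop :=
        add_le_add (liminf_add_liminf_le_ennreal _ _) le_rfl
    _ ≤ liminf (fun j => maxFormKin L ((x ∘ φ) j) + maxFormPot v L ((x ∘ φ) j) +
          ENNReal.ofReal (s * depletion N ((x ∘ φ) j))) atTop := liminf_add_liminf_le_ennreal _ _
    _ ≤ liminf (fun j => c (φ j)) atTop := liminf_le_liminf (Eventually.of_forall fun j => hc (φ j))
    _ = C := (hC.comp hφ.tendsto_atTop).liminf_eq

/-- **The rewarded ground-state class is closed** in `L²` (`R(s) < ∞`). [folklore] -/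
theorem isClosed_rewardedGroundStates (hL : 0 < L) (hv : Measurable v)
    (hW : ∫⁻ X in cellN N L, periodicInteraction v L X ≠ ⊤) {s : ℝ}
    (hR : rewardedGroundStateEnergy hL hv hW s ≠ ⊤) :
    IsClosed (rewardedGroundStates hL hv hW s : Set (L2T N)) := by
  refine isSeqClosed_iff_isClosed.1 fun x η hx hlim => ?_
  refine ⟨isClosed_boseSymmetric.mem_of_tendsto hlim (Eventually.of_forall fun j => (hx j).1), ?_⟩
  refine maxFormR_le_of_tendsto' hL hv hW hlim (fun j => (hx j).2) ?_
  exact ENNReal.Tendsto.const_mul ((ENNReal.continuous_ofReal.tendsto _).comp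
    (((continuous_norm.tendsto η).comp hlim).pow 2)) (Or.inr hR)

/-! ### The rewarded class is a cone; with the rewarded max-form bound it is a subspace -/

/-- The rewarded class is closed under scalars. [folklore] -/
theorem smul_mem_rewardedGroundStates' (hL : 0 < L) (hv : Measurable v)
    (hW : ∫⁻ X in cellN N L, periodicInteraction v L X ≠ ⊤) (s : ℝ) (c : ℂ) {η : L2T N}
    (hη : η ∈ rewardedGroundStates hL hv hW s) : c • η ∈ rewardedGroundStates hL hv hW s := by
  refine ⟨(boseSymmetric N).smul_mem c hη.1, ?_⟩
  rw [maxFormR_smul, norm_smul, mul_pow, ENNReal.ofReal_mul (sq_nonneg _), mul_left_comm]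
  exact mul_le_mul' le_rfl hη.2

/-- **The rewarded class is closed under addition**, given the rewarded max-form bound `R(s)‖ξ‖² ≤ maxFormR ξ` on
the Bose sector and `R(s) < ∞` (parallelogram law). [folklore] -/
theorem add_mem_rewardedGroundStates' (hL : 0 < L) (hv : Measurable v)
    (hW : ∫⁻ X in cellN N L, periodicInteraction v L X ≠ ⊤) {s : ℝ} (hs : 0 ≤ s)
    (hR : rewardedGroundStateEnergy hL hv hW s ≠ ⊤)
    (hbound : ∀ ξ : L2T N, ξ ∈ boseSymmetric N →
      rewardedGroundStateEnergy hL hv hW s * ENNReal.ofReal (‖ξ‖ ^ 2) ≤ maxFormR s v L ξ)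
    {η ξ : L2T N} (hη : η ∈ rewardedGroundStates hL hv hW s) (hξ : ξ ∈ rewardedGroundStates hL hv hW s) :
    η + ξ ∈ rewardedGroundStates hL hv hW s := by
  set E := rewardedGroundStateEnergy hL hv hW s with hEdef
  refine ⟨(boseSymmetric N).add_mem hη.1 hξ.1, ?_⟩
  have hlow : E * ENNReal.ofReal (‖η - ξ‖ ^ 2) ≤ maxFormR s v L (η - ξ) :=
    hbound _ ((boseSymmetric N).sub_mem hη.1 hξ.1)
  have hsum : maxFormR s v L (η + ξ) + maxFormR s v L (η - ξ) ≤
      E * ENNReal.ofReal (‖η + ξ‖ ^ 2) + E * ENNReal.ofReal (‖η - ξ‖ ^ 2) := by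
    rw [maxFormR_parallelogram hs hv]
    calc 2 * maxFormR s v L η + 2 * maxFormR s v L ξ
        ≤ 2 * (E * ENNReal.ofReal (‖η‖ ^ 2)) + 2 * (E * ENNReal.ofReal (‖ξ‖ ^ 2)) := by
          gcongr
          · exact hη.2
          · exact hξ.2
      _ = E * ENNReal.ofReal (2 * ‖η‖ ^ 2 + 2 * ‖ξ‖ ^ 2) := by
          rw [ENNReal.ofReal_add (by positivity) (by positivity), ENNReal.ofReal_mul zero_le_two,
            ENNReal.ofReal_mul zero_le_two, ENNReal.ofReal_ofNat]
          ring
      _ = E * ENNReal.ofReal (‖η + ξ‖ ^ 2 + ‖η - ξ‖ ^ 2) := by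
          congr 1
          congr 1
          have h := parallelogram_law_with_norm ℂ η ξ
          simp only [sq]
          linarith [h]
      _ = E * ENNReal.ofReal (‖η + ξ‖ ^ 2) + E * ENNReal.ofReal (‖η - ξ‖ ^ 2) := by
          rw [ENNReal.ofReal_add (sq_nonneg _) (sq_nonneg _), mul_add]
  have hfin : E * ENNReal.ofReal (‖η - ξ‖ ^ 2) ≠ ⊤ := ENNReal.mul_ne_top hR ENNReal.ofReal_ne_top
  calc maxFormR s v L (η + ξ)
      = maxFormR s v L (η + ξ) + E * ENNReal.ofReal (‖η - ξ‖ ^ 2) - E * ENNReal.ofReal (‖η - ξ‖ ^ 2) :=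
        (ENNReal.add_sub_cancel_right hfin).symm
    _ ≤ maxFormR s v L (η + ξ) + maxFormR s v L (η - ξ) - E * ENNReal.ofReal (‖η - ξ‖ ^ 2) :=
        tsub_le_tsub_right (add_le_add le_rfl hlow) _
    _ ≤ E * ENNReal.ofReal (‖η + ξ‖ ^ 2) + E * ENNReal.ofReal (‖η - ξ‖ ^ 2) - E * ENNReal.ofReal (‖η - ξ‖ ^ 2) :=
        tsub_le_tsub_right hsum _
    _ = E * ENNReal.ofReal (‖η + ξ‖ ^ 2) := ENNReal.add_sub_cancel_right hfin

/-- **Zero-momentum near-minimisers of the rewarded form from a non-zero rewarded ground state**, given the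
rewarded max-form bound on the Bose sector (`s ≥ 0`, `R(s) < ∞`): the rewarded class is then a closed subspace
stable under translations and `|·|`, and `…ZeroMomentumOfGroundState.exists_hasTotalMomentum_rewardedEnergy_le`
applies. [folklore] -/
theorem exists_hasTotalMomentum_of_mem_rewardedGroundStates (hL : 0 < L) (hv : Measurable v)
    (hW : ∫⁻ X in cellN N L, periodicInteraction v L X ≠ ⊤) {s : ℝ} (hs : 0 ≤ s)
    (hR : rewardedGroundStateEnergy hL hv hW s ≠ ⊤)
    (hbound : ∀ ξ : L2T N, ξ ∈ boseSymmetric N →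
      rewardedGroundStateEnergy hL hv hW s * ENNReal.ofReal (‖ξ‖ ^ 2) ≤ maxFormR s v L ξ)
    {η₁ : L2T N} (hη₁ : η₁ ∈ rewardedGroundStates hL hv hW s) (hη₁0 : η₁ ≠ 0) {δ : ℝ≥0∞} (hδ : 0 < δ) :
    ∃ Ψ : PeriodicTrialState N L, HasTotalMomentum 0 Ψ.ψ ∧
      rewardedEnergy hL hv hW s Ψ ≤ rewardedGroundStateEnergy hL hv hW s + δ := by
  let V : Submodule ℂ (L2T N) :=
    { carrier := rewardedGroundStates hL hv hW s
      add_mem' := fun ha hb => add_mem_rewardedGroundStates' hL hv hW hs hR hbound ha hb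
      zero_mem' := ⟨(boseSymmetric N).zero_mem, by rw [maxFormR_zero]; exact bot_le⟩
      smul_mem' := fun c _ hx => smul_mem_rewardedGroundStates' hL hv hW s c hx }
  exact exists_hasTotalMomentum_rewardedEnergy_le hL hv hW hs hR V (isClosed_rewardedGroundStates hL hv hW hR)
    (fun _ hx => hx) (fun b _ hη => translateLp_mem_rewardedGroundStates hL hv hW s b hη)
    (fun _ hη => absLp_mem_rewardedGroundStates' hL hv hW hs hη) hη₁ hη₁0 hδ

/-! ### The rewarded max-form bound: `R(s)‖η‖² ≤ maxFormR η` on the Bose sector -/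

/-- **The rewarded max-form bound for unit classes**: `R(s) ≤ maxFormR s v L η` for a unit Bose-symmetric `η`
(`s ≥ 0`): MaxFormApproximation (`exists_trialState_maxForm_approx`) and the `L²`-Lipschitz bound of the
depletion (`rewardedEnergy_le_maxFormR_add`). [folklore] -/
theorem rewardedGroundStateEnergy_le_maxFormR_of_norm_eq_one (hL : 0 < L) (hv : Measurable v)
    (hW : ∫⁻ X in cellN N L, periodicInteraction v L X ≠ ⊤) {s : ℝ} (hs : 0 ≤ s) {η : L2T N}
    (hη : η ∈ boseSymmetric N) (h1 : ‖η‖ = 1) : rewardedGroundStateEnergy hL hv hW s ≤ maxFormR s v L η := by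
  by_cases hfin : maxForm v L η = ⊤
  · rw [maxFormR_def, hfin, top_add]
    exact le_top
  refine ENNReal.le_of_forall_pos_le_add fun ε hε _ => ?_
  have hc : 0 < 1 + 2 * s * N := by positivity
  have hε' : 0 < (ε : ℝ) / (1 + 2 * s * N) := div_pos (NNReal.coe_pos.2 hε) hc
  obtain ⟨Φ, hE, hdist⟩ := exists_trialState_maxForm_approx hL hv hW hv hW η h1 hη hfin hε'
  calc rewardedGroundStateEnergy hL hv hW s ≤ rewardedEnergy hL hv hW s Φ := rewardedGroundStateEnergy_le hL hv hW s Φ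
    _ ≤ maxFormR s v L η + ENNReal.ofReal ((1 + 2 * s * N) * ((ε : ℝ) / (1 + 2 * s * N))) :=
        rewardedEnergy_le_maxFormR_add hL hv hW hs η h1 Φ hε'.le hE hdist
    _ = maxFormR s v L η + ε := by rw [mul_div_cancel₀ _ hc.ne', ENNReal.ofReal_coe_nnreal]

/-- **The rewarded max-form bound**: `R(s) ‖η‖² ≤ maxFormR s v L η` for every Bose-symmetric `η` (`s ≥ 0`), i.e.
the form `maxFormR - R(s)‖·‖²` is non-negative on the Bose sector. [folklore] -/
theorem rewardedGroundStateEnergy_mul_le_maxFormR' (hL : 0 < L) (hv : Measurable v)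
    (hW : ∫⁻ X in cellN N L, periodicInteraction v L X ≠ ⊤) {s : ℝ} (hs : 0 ≤ s) {η : L2T N}
    (hη : η ∈ boseSymmetric N) :
    rewardedGroundStateEnergy hL hv hW s * ENNReal.ofReal (‖η‖ ^ 2) ≤ maxFormR s v L η := by
  by_cases h0 : η = 0
  · rw [h0, norm_zero, sq, zero_mul, ENNReal.ofReal_zero, mul_zero]
    exact bot_le
  have hn : 0 < ‖η‖ := norm_pos_iff.2 h0
  set ξ : L2T N := ((‖η‖⁻¹ : ℝ) : ℂ) • η with hξdef
  have hξ1 : ‖ξ‖ = 1 := by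
    rw [hξdef, norm_smul, Complex.norm_real, Real.norm_of_nonneg (inv_nonneg.2 hn.le), inv_mul_cancel₀ hn.ne']
  have hξ : ξ ∈ boseSymmetric N := (boseSymmetric N).smul_mem _ hη
  have hηξ : η = ((‖η‖ : ℝ) : ℂ) • ξ := by
    rw [hξdef, smul_smul, ← Complex.ofReal_mul, mul_inv_cancel₀ hn.ne', Complex.ofReal_one, one_smul]
  have h := rewardedGroundStateEnergy_le_maxFormR_of_norm_eq_one hL hv hW hs hξ hξ1
  calc rewardedGroundStateEnergy hL hv hW s * ENNReal.ofReal (‖η‖ ^ 2)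
      = ENNReal.ofReal (‖((‖η‖ : ℝ) : ℂ)‖ ^ 2) * rewardedGroundStateEnergy hL hv hW s := by
        rw [mul_comm, Complex.norm_real, Real.norm_of_nonneg hn.le]
    _ ≤ ENNReal.ofReal (‖((‖η‖ : ℝ) : ℂ)‖ ^ 2) * maxFormR s v L ξ := mul_le_mul' le_rfl h
    _ = maxFormR s v L η := by rw [← maxFormR_smul, ← hηξ]

/-! ### Existence of a non-zero rewarded ground state (direct method, compactness of the form embedding) -/

/-- **The rewarded ground-state class is non-trivial** (`R(s) < ∞`): a minimising sequence of trial
states has bounded graph norm, hence (Rellich, `isCompactOperator_formEmbed`) an `L²`-convergent subsequence of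
embedded classes, whose limit is a unit Bose-symmetric class with `maxFormR ≤ R(s)` by lower semicontinuity.
[folklore] -/
theorem exists_ne_zero_mem_rewardedGroundStates' (hL : 0 < L) (hv : Measurable v)
    (hW : ∫⁻ X in cellN N L, periodicInteraction v L X ≠ ⊤) {s : ℝ}
    (hR : rewardedGroundStateEnergy hL hv hW s ≠ ⊤) :
    ∃ η ∈ rewardedGroundStates hL hv hW s, η ≠ 0 := by
  set R' := rewardedGroundStateEnergy hL hv hW s with hR'
  -- a minimising sequence
  set e : ℕ → ℝ≥0∞ := fun j => ((j : ℝ≥0∞) + 1)⁻¹ with he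
  have he0 : ∀ j, e j ≠ 0 := fun j => ENNReal.inv_ne_zero.2 (ENNReal.add_ne_top.2 ⟨ENNReal.natCast_ne_top j, ENNReal.one_ne_top⟩)
  have he1 : ∀ j, e j ≤ 1 := fun j => by
    rw [he]
    exact ENNReal.inv_le_one.2 le_add_self
  have helim : Tendsto e atTop (𝓝 0) := by
    have h : Tendsto (fun j : ℕ => (j : ℝ≥0∞) + 1) atTop (𝓝 ⊤) := by
      have h1 := ENNReal.tendsto_nat_nhds_top.comp (tendsto_add_atTop_nat 1)
      refine h1.congr fun j => ?_
      simp only [Function.comp_apply, Nat.cast_add, Nat.cast_one]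
    have h2 := (tendsto_inv_iff (G := ℝ≥0∞) (a := (⊤ : ℝ≥0∞))).2 h
    rwa [ENNReal.inv_top] at h2
  have hmin : ∀ j : ℕ, ∃ Ψ : PeriodicTrialState N L, rewardedEnergy hL hv hW s Ψ < R' + e j := fun j =>
    iInf_lt_iff.1 (ENNReal.lt_add_right hR (he0 j))
  choose Ψ hΨ using hmin
  -- the graph vectors and the embedded classes
  set u : ℕ → formDomain hL hv hW := fun j =>
    ⟨graphEmbed hL hv hW ⟨(Ψ j).ψ, (Ψ j).mem_periodicCore⟩, graphEmbed_mem_formDomain hL hv hW _⟩ with hu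
  set x : ℕ → L2T N := fun j => formEmbed hL hv hW (u j) with hx
  have hx1 : ∀ j, ‖x j‖ = 1 := fun j => norm_formEmbed_graphEmbed_trialState hL hv hW (Ψ j)
  have hR1 : R' + 1 ≠ ⊤ := ENNReal.add_ne_top.2 ⟨hR, ENNReal.one_ne_top⟩
  have hEle : ∀ j, periodicEnergy v (Ψ j) ≤ R' + 1 := fun j =>
    (le_self_add.trans (hΨ j).le).trans (add_le_add le_rfl (he1 j))
  set r : ℝ := Real.sqrt (1 + (R' + 1).toReal) with hr
  have hub : ∀ j, ‖u j‖ ≤ r := fun j => by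
    rw [hr, ← Real.sqrt_sq (norm_nonneg (u j))]
    refine Real.sqrt_le_sqrt ?_
    have h := norm_graphEmbed_sq_trialState hL hv hW (Ψ j)
    rw [show ‖u j‖ = ‖graphEmbed hL hv hW ⟨(Ψ j).ψ, (Ψ j).mem_periodicCore⟩‖ from rfl, h]
    exact add_le_add le_rfl (ENNReal.toReal_mono hR1 (hEle j))
  -- compactness of the embedding
  have hcpt : IsCompactOperator ((formEmbed hL hv hW : formDomain hL hv hW →ₗ[ℂ] L2T N) : formDomain hL hv hW → L2T N) :=
    isCompactOperator_formEmbed hL hv hW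
  have hK := hcpt.isCompact_closure_image_closedBall r
  have hxK : ∀ j, x j ∈ closure ((formEmbed hL hv hW : formDomain hL hv hW →ₗ[ℂ] L2T N) '' Metric.closedBall 0 r) :=
    fun j => subset_closure ⟨u j, mem_closedBall_zero_iff.2 (hub j), rfl⟩
  obtain ⟨η, -, φ, hφ, hlim⟩ := hK.tendsto_subseq hxK
  -- the limit is a unit Bose-symmetric class with `maxFormR ≤ R(s)`
  have hη1 : ‖η‖ = 1 := by
    have h1 : Tendsto (fun j => ‖(x ∘ φ) j‖) atTop (𝓝 ‖η‖) := (continuous_norm.tendsto η).comp hlim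
    have h2 : Tendsto (fun j => ‖(x ∘ φ) j‖) atTop (𝓝 1) := by
      simp only [Function.comp_apply, hx1]
      exact tendsto_const_nhds
    exact tendsto_nhds_unique h1 h2
  have hηsymm : η ∈ boseSymmetric N :=
    isClosed_boseSymmetric.mem_of_tendsto hlim (Eventually.of_forall fun j => formEmbed_mem_boseSymmetric hL hv hW (u (φ j)))
  have hcj : ∀ j, maxFormR s v L (x j) ≤ rewardedEnergy hL hv hW s (Ψ j) := fun j => by
    rw [maxFormR_def, rewardedEnergy_def, periodicEnergy_eq_maxForm hL hv hW hv (Ψ j)]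
    rfl
  have hC : Tendsto (fun j => rewardedEnergy hL hv hW s (Ψ (φ j))) atTop (𝓝 R') := by
    have hup : Tendsto (fun j => R' + e (φ j)) atTop (𝓝 R') := by
      have h := (helim.comp hφ.tendsto_atTop).const_add R'
      rwa [add_zero] at h
    exact tendsto_of_tendsto_of_tendsto_of_le_of_le tendsto_const_nhds hup
      (fun j => rewardedGroundStateEnergy_le hL hv hW s _) (fun j => (hΨ (φ j)).le)
  have hηR : maxFormR s v L η ≤ R' := maxFormR_le_of_tendsto' hL hv hW hlim (fun j => hcj (φ j)) hC
  refine ⟨η, ⟨hηsymm, ?_⟩, norm_ne_zero_iff.1 (by rw [hη1]; exact one_ne_zero)⟩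
  rw [hη1, one_pow, ENNReal.ofReal_one, mul_one]
  exact hηR

end Summit.AtomisticToContinuum.BoseEinsteinCondensation.Cruxes.RewardChordBound.Birth.ZeroMomentumIntegrable

namespace Summit.AtomisticToContinuum.BoseEinsteinCondensation.Cruxes.RewardChordBound.Birth

open Literature.MathematicalPhysics.QuantumManyBody.BoseGas
open Summit.AtomisticToContinuum.BoseEinsteinCondensation.Cruxes.RewardChordBound.Birth.ZeroMomentumIntegrable
  Summit.AtomisticToContinuum.BoseEinsteinCondensation.Cruxes.RewardChordBound.Birth.DepletionDictionary

/-- **stub 4b — `RewardedZeroMomentumIntegrable` (Perron–Frobenius input, part (ii), INTEGRABLE pair potentials,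
every `N ≥ 1`, `L > 0`, `s > 0`).** For a repulsive finite-range `v` with `∫ v(|x|)dx < ∞` and `R(s) < ∞`, the
rewarded functional `F_s = ⟨·,H·⟩ + s(N - n̂₀)` has translation-invariant near-minimisers at every precision:
`∀ δ > 0 ∃ Ψ`, `Ψ(X + (t,…,t)) = Ψ(X)`, `F_s(Ψ) ≤ R(s) + δ`. Proof: the rewarded ground-state class of the
Literature max-form package is a non-trivial closed subspace of `L²((ℝ/ℤ)^{3N})` stable under diagonal
translations and `|·|` (rewarded max-form bound, parallelogram law, lower semicontinuity, Rellich, Beurling–Deny for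
the depletion); the zero-momentum part of `|η₁|` for a non-zero ground state `η₁` is a non-zero translation-invariant
ground state, approximated in the rewarded form by zero-momentum core states; and `rewardedEnergy = F_s`
(depletion dictionary). No uniqueness of the ground state is needed.
[cite: ReedSimonIV1978, §XIII.12 and Thm XIII.64] -/
theorem stub_rewardedZeroMomentumIntegrable :
    ∀ v : ℝ → ENNReal, Literature.MathematicalPhysics.QuantumManyBody.BoseGas.IsRepulsiveFiniteRange v → (∫⁻ x : Literature.MathematicalPhysics.QuantumManyBody.BoseGas.Space, v ‖x‖) ≠ ⊤ → ∀ (N : ℕ) (L s : ℝ), 1 ≤ N → 0 < L → 0 < s → (⨅ Ψ : Literature.MathematicalPhysics.QuantumManyBody.BoseGas.PeriodicTrialState N L, (Literature.MathematicalPhysics.QuantumManyBody.BoseGas.periodicEnergy v Ψ + ENNReal.ofReal s * ((N : ENNReal) - Literature.MathematicalPhysics.QuantumManyBody.BoseGas.condensateOccupation N L Ψ.ψ))) ≠ ⊤ → (∀ δ : ENNReal, 0 < δ → ∃ Ψ : Literature.MathematicalPhysics.QuantumManyBody.BoseGas.PeriodicTrialState N L, (∀ (X : Literature.MathematicalPhysics.QuantumManyBody.BoseGas.Config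 N) (t : EuclideanSpace ℝ (Fin 3)), Ψ.ψ (fun i => X i + t) = Ψ.ψ X) ∧ (Literature.MathematicalPhysics.QuantumManyBody.BoseGas.periodicEnergy v Ψ + ENNReal.ofReal s * ((N : ENNReal) - Literature.MathematicalPhysics.QuantumManyBody.BoseGas.condensateOccupation N L Ψ.ψ)) ≤ (⨅ Ψ : Literature.MathematicalPhysics.QuantumManyBody.BoseGas.PeriodicTrialState N L, (Literature.MathematicalPhysics.QuantumManyBody.BoseGas.periodicEnergy v Ψ + ENNReal.ofReal s * ((N : ENNReal) - Literature.MathematicalPhysics.QuantumManyBody.BoseGas.condensateOccupation N L Ψ.ψ))) + δ) := by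
  intro v hv hint N L s _ hL hs hR δ hδ
  have hvm : Measurable v := hv.1
  have hW := lintegral_cellN_periodicInteraction_ne_top_of_lintegral_ne_top hL hvm hint N
  rw [← rewardedGroundStateEnergy_eq_iInf hL hvm hW hs.le] at hR ⊢
  obtain ⟨η₁, hη₁, hη₁0⟩ := exists_ne_zero_mem_rewardedGroundStates' hL hvm hW hR
  obtain ⟨Ψ, hmom, hE⟩ := exists_hasTotalMomentum_of_mem_rewardedGroundStates hL hvm hW hs.le hR
    (fun ξ hξ => rewardedGroundStateEnergy_mul_le_maxFormR' hL hvm hW hs.le hξ) hη₁ hη₁0 hδ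
  refine ⟨Ψ, fun X t => (hasTotalMomentum_zero_iff.1 hmom) t X, ?_⟩
  rw [← rewardedEnergy_eq hL hvm hW hs.le Ψ]
  exact hE

end Summit.AtomisticToContinuum.BoseEinsteinCondensation.Cruxes.RewardChordBound.Birth

end
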